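import Literature.InformationTheory.QuantumCodes.TwoBlockConnectedComponents
import Literature.InformationTheory.QuantumCodes.CSSParameters
import HarnessLib

/-!
# Parameters of the connected ROOT code of an abelian two-block code: `c × [[n/c, k/c, d]]`

Bravyi–Cross–Gambetta–Maslov–Rall–Yoder [BravyiEtAl2024, §4, after Lemma 3 (arXiv:2308.07915 chunk
p0011 L7–10)]: a two-block code `QC(A,B)` whose Tanner graph has `c = ℓm/|⟨S⟩|` connected components
"is actually several separable code blocks"; Lin–Pryadko [LinPryadko2024, §4.3 / Statement 7
(arXiv:2306.16400 chunk p0010 L1–55)]: the code is the direct sum of the coset subcodes, each a 2BGA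
code over the subgroup `⟨S⟩`. The tree already has the connected normal form
(`TwoBlockConnectedComponents.lean`, qec-type-05 gen 3: `rootA`/`rootB` on `↥(diffSubgroup a b)`,
`css_dX_eq_root`, `css_dZ_eq_root`, `css_k_eq_index_mul_root`, `card_qubits_eq_index_mul_root`,
`root_tannerGraph_connected`, `card_connectedComponent_eq_index`).

This file packages those equalities as the census statement: **if `css a b` is an `[[n, k, d]]` code
with `c` Tanner components, then its connected root code `css (rootA a b s₀) (rootB a b t₀)` is an
`[[n/c, k/c, d]]` code** (`AbelianTwoBlock.root_isCode`, with `c ∣ n`, `c ∣ k`), and the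
bivariate-bicycle phrasing `BB.Code.root_isCode` for `QC(A,B)` on `ℤ_ℓ × ℤ_m` — so that a census
row certified `[[n,k,d]]` with a kernel-certified component count `c` reads «`= c ×` a CONNECTED
`[[n/c, k/c, d]]` two-block code over `⟨S⟩`» as a kernel theorem about a named typed object, not
only numerically. PROVED; no named facts; axioms standard.
-/

namespace Literature.InformationTheory.QuantumCodes

namespace AbelianTwoBlock

variable {G : Type} [Fintype G] [AddCommGroup G]

section Root

variable {a b : G → ZMod 2} [DecidablePred (· ∈ diffSubgroup a b)] {s₀ t₀ : G}

/-- The number of Tanner components `c` of a two-block code with both blocks non-zero divides the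
qubit count, and the root code has `n / c` qubits.
[cite: BravyiEtAl2024, Lemma 3 (ii) "ℓm/|⟨S⟩|" (arXiv:2308.07915 chunk p0011 L10)] -/
theorem card_root_qubits_eq_div (hs₀ : a s₀ ≠ 0) (ht₀ : b t₀ ≠ 0) {c : ℕ}
    (hc : Nat.card (css a b).tannerGraph.ConnectedComponent = c) :
    Fintype.card (↥(diffSubgroup a b) ⊕ ↥(diffSubgroup a b)) = Fintype.card (G ⊕ G) / c ∧
      c ∣ Fintype.card (G ⊕ G) := by
  have ha : a ≠ 0 := fun h => hs₀ (by simp [h])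
  have hb : b ≠ 0 := fun h => ht₀ (by simp [h])
  have hidx : (diffSubgroup a b).index = c := (card_connectedComponent_eq_index ha hb).symm.trans hc
  have hsplit := card_qubits_eq_index_mul_root (a := a) (b := b)
  rw [hidx] at hsplit
  have hcpos : 0 < c := hidx ▸ AddSubgroup.index_ne_zero_iff_finite.mpr inferInstance |> Nat.pos_of_ne_zero
  refine ⟨?_, ⟨_, hsplit⟩⟩
  rw [hsplit, Nat.mul_div_cancel_left _ hcpos]

/-- **ROOT PARAMETERS.** If the abelian two-block code `css a b` (both blocks non-zero) is an
`[[n, k, d]]` code and its Tanner graph has `c` connected components, then its connected root code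
over `⟨S⟩` is an `[[n / c, k / c, d]]` code, with `c ∣ n` and `c ∣ k`: the printed "several separable
code blocks" made quantitative (`n` and `k` split evenly over the `c` isomorphic components, the
distance is that of one component).
[cite: BravyiEtAl2024, §4 after Lemma 3 (arXiv:2308.07915 chunk p0011 L7–10)]
[cite: LinPryadko2024, §4.3 / Statement 7 (arXiv:2306.16400 chunk p0010 L1–55)] -/
theorem root_isCode (hs₀ : a s₀ ≠ 0) (ht₀ : b t₀ ≠ 0) {n k d c : ℕ} (h : (css a b).IsCode n k d)
    (hc : Nat.card (css a b).tannerGraph.ConnectedComponent = c) :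
    (css (rootA a b s₀) (rootB a b t₀)).IsCode (n / c) (k / c) d ∧ c ∣ n ∧ c ∣ k := by
  have ha : a ≠ 0 := fun h0 => hs₀ (by simp [h0])
  have hb : b ≠ 0 := fun h0 => ht₀ (by simp [h0])
  have hidx : (diffSubgroup a b).index = c := (card_connectedComponent_eq_index ha hb).symm.trans hc
  have hcpos : 0 < c := hidx ▸ AddSubgroup.index_ne_zero_iff_finite.mpr inferInstance |> Nat.pos_of_ne_zero
  have hkpos : 0 < (css a b).k := h.2.1.symm ▸ h.k_pos
  obtain ⟨hn, hk, hmin⟩ := ((css a b).isCode_iff hkpos).1 h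
  have hkroot := css_k_eq_index_mul_root hs₀ ht₀
  rw [hidx] at hkroot
  have hkroot' : (css (rootA a b s₀) (rootB a b t₀)).k = k / c := by
    rw [← hk, hkroot, Nat.mul_div_cancel_left _ hcpos]
  have hkrootpos : 0 < (css (rootA a b s₀) (rootB a b t₀)).k := by
    rcases Nat.eq_zero_or_pos (css (rootA a b s₀) (rootB a b t₀)).k with h0 | hpos
    · rw [hkroot, h0, mul_zero] at hkpos; exact absurd hkpos (lt_irrefl 0)
    · exact hpos
  obtain ⟨hcard, hdvdn⟩ := card_root_qubits_eq_div hs₀ ht₀ hc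
  refine ⟨((css (rootA a b s₀) (rootB a b t₀)).isCode_iff hkrootpos).2 ⟨?_, hkroot', ?_⟩, hn ▸ hdvdn,
    ⟨_, hk ▸ hkroot⟩⟩
  · rw [hcard, hn]
  · rw [← css_dX_eq_root hs₀ ht₀, ← css_dZ_eq_root hs₀ ht₀, hmin]

end Root

end AbelianTwoBlock

/-! ### Bivariate-bicycle phrasing (classical decidability of `· ∈ ⟨S⟩`, so that instances need no
decidability bookkeeping: state them under `open scoped Classical in`) -/

namespace BB.Code

open AbelianTwoBlock
open scoped Classical

variable {ℓ m : ℕ} [NeZero ℓ] [NeZero m] (C : Code ℓ m)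

/-- The connected ROOT code of `QC(A,B)` at base exponents `g₀ ∈ supp A`, `h₀ ∈ supp B`: the abelian
two-block code over the exponent-difference subgroup `⟨S⟩ ≤ ℤ_ℓ × ℤ_m` with blocks the restricted,
re-based coefficient vectors (`AbelianTwoBlock.rootA/rootB` of `coeffVec A`, `coeffVec B` at `−g₀`,
`−h₀`; membership in `⟨S⟩` decided classically). (definition)
[cite: BravyiEtAl2024, Lemma 3 (arXiv:2308.07915 chunk p0011 L7–10)]
[cite: LinPryadko2024, Statement 7 (arXiv:2306.16400 chunk p0010 L47–55)] -/
noncomputable def rootCode (g₀ h₀ : Mono ℓ m) :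
    CSSCode ↥(diffSubgroup (coeffVec C.A) (coeffVec C.B)) ↥(diffSubgroup (coeffVec C.A) (coeffVec C.B))
      (↥(diffSubgroup (coeffVec C.A) (coeffVec C.B)) ⊕ ↥(diffSubgroup (coeffVec C.A) (coeffVec C.B))) :=
  AbelianTwoBlock.css (rootA (coeffVec C.A) (coeffVec C.B) (-g₀)) (rootB (coeffVec C.A) (coeffVec C.B) (-h₀))

/-- **ROOT PARAMETERS for `QC(A,B)`**: if `QC(A,B)` is an `[[n, k, d]]` code with `c` Tanner components
and `g₀`, `h₀` are exponents of `A`, `B`, then the connected root code `C.rootCode g₀ h₀` is an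
`[[n / c, k / c, d]]` code, its Tanner graph is connected, and `c ∣ n`, `c ∣ k` — the census reading
«`= c × [[n/c, k/c, d]]`» as a kernel statement about a typed object.
[cite: BravyiEtAl2024, §4 after Lemma 3 (arXiv:2308.07915 chunk p0011 L7–10)]
[cite: LinPryadko2024, §4.3 / Statement 7 (arXiv:2306.16400 chunk p0010 L1–55)] -/
theorem rootCode_isCode {g₀ h₀ : Mono ℓ m} (hg : C.A g₀ ≠ 0) (hh : C.B h₀ ≠ 0) {n k d c : ℕ}
    (h : C.css.IsCode n k d) (hc : Nat.card C.css.tannerGraph.ConnectedComponent = c) :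
    (C.rootCode g₀ h₀).IsCode (n / c) (k / c) d ∧ (C.rootCode g₀ h₀).tannerGraph.Connected ∧
      c ∣ n ∧ c ∣ k := by
  have hg' : coeffVec C.A (-g₀) ≠ 0 := by simpa using hg
  have hh' : coeffVec C.B (-h₀) ≠ 0 := by simpa using hh
  rw [css_eq] at h hc
  obtain ⟨hroot, hdn, hdk⟩ := AbelianTwoBlock.root_isCode hg' hh' h hc
  exact ⟨hroot, root_tannerGraph_connected hg' hh', hdn, hdk⟩

end BB.Code

end Literature.InformationTheory.QuantumCodes
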